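import Mathlib
import Literature.NumberTheory.LFunctions.TaoHoeffding
import Summits.Parity.GeneralizedHardyLittlewood.Theorems.LeeYangFibresRelativeDimOneSplitLocalIdentity

/-!
# Sloped ladder, Euler stub — part 1: arithmetic of the sieve weight `w̃(d)`

Route `LiouvilleShiftedTables` (Parity / GeneralizedHardyLittlewood), crux stmt-Parity-9389
(`PairsToGHL`), line `sloped_ladder`, stub `stub_slopedEuler`.

For a positive `t`-system `Φᵢ(n) = aᵢ n + cᵢ` and a positive form `ψ(n) = α n + β` the rung of the
ladder meets, for every modulus `d`, the weight

  `w̃(d) = ∑_{ρ < d'} 𝟙[d ∣ α ρ + β] · 𝟙[ρ admissible mod d'] / #{admissible classes mod d'}`,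

`d' = d / gcd(α, d)`, "admissible mod `q`" meaning `gcd(aᵢ ρ + cᵢ, q) = 1` for all `i` (the sum has
at most one non-zero term). No definition is introduced: the weight is carried by a function
`W : ℕ → ℝ` together with the displayed formula as hypothesis `hW`. This file proves the arithmetic
facts the Euler-product bookkeeping needs:

* `weight_nonneg`, `weight_le_one`, `weight_one` — `0 ≤ w̃ ≤ 1`, `w̃(1) = 1`;
* `weight_mul` — `w̃(m n) = w̃(m) w̃(n)` for coprime `m, n ≥ 1` (Chinese remainder theorem);
* `weight_prime_mul_card` — at a prime `p`: `w̃(p) · #{good classes} = #{good roots of ψ mod p}`;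
* `card_roots_eq_one`, `card_good_ge`, `abs_one_sub_mul_weight_le`,
  `abs_one_sub_mul_weight_le_div` — for `p ∤ α` the form `ψ` has exactly one root mod `p`, at most
  `t` classes are bad, hence `|1 - p w̃(p)| ≤ 1 + p` always and `≤ 2t/p` at the unexceptional primes.

[folklore]
-/

open Finset

namespace Summit.Parity.GeneralizedHardyLittlewood.Theorems.PairsToGHL.SlopedLadder

open Summit.Parity.GeneralizedHardyLittlewood.Cruxes.RelativeDimOne.GallagherBackwardsSplit
  (card_coprime_classes_mul int_gcd_linear_mod int_gcd_mul_eq_one_iff)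

variable {t : ℕ}

/-! ### Elementary `gcd` facts -/

/-- For a prime `p`: `gcd(x, p) = 1 ↔ p ∤ x`. [folklore] -/
theorem int_gcd_prime_eq_one_iff {p : ℕ} (hp : p.Prime) (x : ℤ) :
    Int.gcd x p = 1 ↔ ¬ (p : ℤ) ∣ x := by
  rw [Int.natCast_dvd, ← hp.coprime_iff_not_dvd, Nat.coprime_comm, Nat.coprime_iff_gcd_eq_one,
    Int.gcd_eq_natAbs, Int.natAbs_natCast]

/-- For a prime `p`: `gcd(α, p) = p` if `p ∣ α` and `= 1` otherwise. [folklore] -/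
theorem int_gcd_prime_right {p : ℕ} (hp : p.Prime) (α : ℤ) :
    Int.gcd α p = if (p : ℤ) ∣ α then p else 1 := by
  split_ifs with h
  · rw [Int.gcd_eq_natAbs, Int.natAbs_natCast]
    exact Nat.gcd_eq_right (Int.natCast_dvd.mp h)
  · exact (int_gcd_prime_eq_one_iff hp α).mpr h

/-- The admissible count modulo `1` is `1`. [folklore] -/
theorem card_admissible_one (a c : Fin t → ℤ) :
    #((range 1).filter (fun ρ' : ℕ => ∀ i, Int.gcd (a i * ρ' + c i) (1 : ℕ) = 1)) = 1 := by
  rw [Finset.card_eq_one]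
  refine ⟨0, ?_⟩
  ext ρ
  simp only [Finset.mem_filter, Finset.mem_range, Nat.lt_one_iff, Nat.cast_one, Int.gcd_one_right,
    implies_true, and_true, Finset.mem_singleton]

section Weight

variable (a c : Fin t → ℤ) (α β : ℤ) {W : ℕ → ℝ}
  (hW : ∀ d : ℕ, W d = ∑ ρ ∈ range (d / Int.gcd α d),
      if (d : ℤ) ∣ α * ρ + β then
        (if ∀ i, Int.gcd (a i * ρ + c i) (d / Int.gcd α d : ℕ) = 1 then
          ((#((range (d / Int.gcd α d)).filter (fun ρ' : ℕ =>
            ∀ i, Int.gcd (a i * ρ' + c i) (d / Int.gcd α d : ℕ) = 1)) : ℝ))⁻¹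
        else 0)
      else 0)
include hW

/-! ### `0 ≤ w̃ ≤ 1`, `w̃(1) = 1` -/

/-- `w̃(d) ≥ 0`. [folklore] -/
theorem weight_nonneg (d : ℕ) : 0 ≤ W d := by
  rw [hW]
  refine Finset.sum_nonneg fun ρ _ => ?_
  split_ifs <;> simp

/-- `w̃(d) ≤ 1`: dropping the divisibility indicator leaves `#adm · (#adm)⁻¹ ≤ 1`. [folklore] -/
theorem weight_le_one (d : ℕ) : W d ≤ 1 := by
  rw [hW]
  set q : ℕ := d / Int.gcd α d
  set N : ℝ := (#((range q).filter (fun ρ' : ℕ => ∀ i, Int.gcd (a i * ρ' + c i) q = 1)) : ℝ)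
  calc (∑ ρ ∈ range q, if (d : ℤ) ∣ α * ρ + β then
          (if ∀ i, Int.gcd (a i * ρ + c i) q = 1 then N⁻¹ else 0) else 0)
      ≤ ∑ ρ ∈ range q, (if ∀ i, Int.gcd (a i * ρ + c i) q = 1 then N⁻¹ else 0) := by
        refine Finset.sum_le_sum fun ρ _ => ?_
        split_ifs <;> simp [N]
    _ = N * N⁻¹ := by
        rw [← Finset.sum_filter, Finset.sum_const, nsmul_eq_mul]
    _ ≤ 1 := by
        rcases eq_or_ne N 0 with h | h
        · simp [h]
        · simp [h]

/-- `w̃(1) = 1`. [folklore] -/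
theorem weight_one : W 1 = 1 := by
  rw [hW, Nat.cast_one, Int.gcd_one_right, Nat.div_one, Finset.sum_range_one, card_admissible_one]
  simp

/-! ### Multiplicativity (Chinese remainder theorem) -/

/-- **`w̃` is multiplicative**: `w̃(m n) = w̃(m) w̃(n)` for coprime `m, n ≥ 1`. With
`gᵢ = gcd(α, ·)`, `gcd(α, mn) = g₁ g₂` and `(mn)' = m' n'` with `m', n'` coprime; the divisibility
`m ∣ α ρ + β` and admissibility mod `m'` only depend on `ρ mod m'`, the admissible counts multiply
(`card_coprime_classes_mul`), and `ρ ↦ (ρ mod m', ρ mod n')` is the CRT bijection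
(`Tao2016.sum_range_mul_mod`). [folklore] -/
theorem weight_mul {m n : ℕ} (hm : 0 < m) (hn : 0 < n) (hmn : m.Coprime n) :
    W (m * n) = W m * W n := by
  -- the gcds and the reduced moduli
  have hg : Int.gcd α (m * n : ℕ) = Int.gcd α m * Int.gcd α n := by
    simp only [Int.gcd_eq_natAbs, Int.natAbs_natCast]
    exact Nat.Coprime.gcd_mul _ hmn
  have hg₁m : Int.gcd α m ∣ m := by
    have := Int.gcd_dvd_right α m
    rwa [Int.natCast_dvd_natCast] at this
  have hg₂n : Int.gcd α n ∣ n := by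
    have := Int.gcd_dvd_right α n
    rwa [Int.natCast_dvd_natCast] at this
  have hg₁0 : 0 < Int.gcd α m :=
    Nat.pos_of_ne_zero fun h => hm.ne' (by exact_mod_cast (Int.gcd_eq_zero_iff.mp h).2)
  have hg₂0 : 0 < Int.gcd α n :=
    Nat.pos_of_ne_zero fun h => hn.ne' (by exact_mod_cast (Int.gcd_eq_zero_iff.mp h).2)
  set q₁ : ℕ := m / Int.gcd α m with hq₁
  set q₂ : ℕ := n / Int.gcd α n with hq₂
  have hq : m * n / Int.gcd α (m * n : ℕ) = q₁ * q₂ := by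
    rw [hg, hq₁, hq₂, Nat.div_mul_div_comm hg₁m hg₂n]
  have hq₁0 : 0 < q₁ := Nat.div_pos (Nat.le_of_dvd hm hg₁m) hg₁0
  have hq₂0 : 0 < q₂ := Nat.div_pos (Nat.le_of_dvd hn hg₂n) hg₂0
  have hmq : m = Int.gcd α m * q₁ := (Nat.mul_div_cancel' hg₁m).symm
  have hnq : n = Int.gcd α n * q₂ := (Nat.mul_div_cancel' hg₂n).symm
  have hcop : q₁.Coprime q₂ :=
    Nat.Coprime.coprime_dvd_left (Nat.div_dvd_of_dvd hg₁m)
      (Nat.Coprime.coprime_dvd_right (Nat.div_dvd_of_dvd hg₂n) hmn)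
  -- divisibility by `m` only depends on `ρ mod q₁` (as `m ∣ α q₁`), same for `n`
  have hdvd_mod : ∀ {k q : ℕ}, k = Int.gcd α k * q → 0 < q → ∀ ρ : ℕ,
      ((k : ℤ) ∣ α * ρ + β ↔ (k : ℤ) ∣ α * ((ρ % q : ℕ) : ℤ) + β) := by
    intro k q hk _ ρ
    obtain ⟨e, he⟩ := Int.gcd_dvd_left α k
    have h1 : (ρ : ℤ) ≡ ((ρ % q : ℕ) : ℤ) [ZMOD q] := by
      rw [Int.natCast_mod]
      exact (Int.emod_emod_of_dvd _ (dvd_refl _)).symm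
    have h2 : α * ρ ≡ α * ((ρ % q : ℕ) : ℤ) [ZMOD α * q] := h1.mul_left'
    have hkq : (k : ℤ) ∣ α * q := ⟨e, by
      conv_lhs => rw [he]
      conv_rhs => rw [hk]
      push_cast; ring⟩
    have h3 : α * ρ + β ≡ α * ((ρ % q : ℕ) : ℤ) + β [ZMOD k] := (h2.of_dvd hkq).add_right β
    rw [Int.dvd_iff_emod_eq_zero, Int.dvd_iff_emod_eq_zero, h3]
  -- `mn ∣ x ↔ m ∣ x ∧ n ∣ x`
  have hdvd_mul : ∀ x : ℤ, ((m * n : ℕ) : ℤ) ∣ x ↔ (m : ℤ) ∣ x ∧ (n : ℤ) ∣ x := by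
    intro x
    simp only [Int.natCast_dvd]
    exact ⟨fun h => ⟨(dvd_mul_right m n).trans h, (dvd_mul_left n m).trans h⟩,
      fun h => hmn.mul_dvd_of_dvd_of_dvd h.1 h.2⟩
  -- admissibility mod `q₁ q₂` splits
  have hadm : ∀ ρ : ℕ, (∀ i, Int.gcd (a i * ρ + c i) (q₁ * q₂ : ℕ) = 1) ↔
      (∀ i, Int.gcd (a i * ((ρ % q₁ : ℕ) : ℤ) + c i) q₁ = 1) ∧
        (∀ i, Int.gcd (a i * ((ρ % q₂ : ℕ) : ℤ) + c i) q₂ = 1) := by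
    intro ρ
    constructor
    · intro h
      exact ⟨fun i => by
          rw [← int_gcd_linear_mod (dvd_refl q₁)]
          exact ((int_gcd_mul_eq_one_iff _ q₁ q₂).1 (h i)).1,
        fun i => by
          rw [← int_gcd_linear_mod (dvd_refl q₂)]
          exact ((int_gcd_mul_eq_one_iff _ q₁ q₂).1 (h i)).2⟩
    · rintro ⟨h1, h2⟩ i
      rw [int_gcd_mul_eq_one_iff]
      exact ⟨by rw [int_gcd_linear_mod (dvd_refl q₁)]; exact h1 i,
        by rw [int_gcd_linear_mod (dvd_refl q₂)]; exact h2 i⟩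
  have hN : (#((range (q₁ * q₂)).filter (fun ρ' : ℕ =>
      ∀ i, Int.gcd (a i * ρ' + c i) (q₁ * q₂ : ℕ) = 1)) : ℝ) =
      (#((range q₁).filter (fun ρ' : ℕ => ∀ i, Int.gcd (a i * ρ' + c i) q₁ = 1)) : ℝ) *
        (#((range q₂).filter (fun ρ' : ℕ => ∀ i, Int.gcd (a i * ρ' + c i) q₂ = 1)) : ℝ) := by
    rw [← Nat.cast_mul, card_coprime_classes_mul hq₁0 hq₂0 hcop a c]
  -- the computation
  rw [hW (m * n), hW m, hW n, hq, Finset.sum_mul_sum,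
    ← Literature.NumberTheory.LFunctions.Tao2016.sum_range_mul_mod q₁ q₂ hq₁0 hq₂0 hcop]
  refine Finset.sum_congr rfl fun ρ _ => ?_
  rw [← ite_and, ← ite_and, ← ite_and, ite_zero_mul_ite_zero, hN, ← mul_inv]
  have hiff : (((m * n : ℕ) : ℤ) ∣ α * ρ + β ∧ ∀ i, Int.gcd (a i * ρ + c i) (q₁ * q₂ : ℕ) = 1) ↔
      (((m : ℤ) ∣ α * ((ρ % q₁ : ℕ) : ℤ) + β ∧
          ∀ i, Int.gcd (a i * ((ρ % q₁ : ℕ) : ℤ) + c i) q₁ = 1) ∧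
        ((n : ℤ) ∣ α * ((ρ % q₂ : ℕ) : ℤ) + β ∧
          ∀ i, Int.gcd (a i * ((ρ % q₂ : ℕ) : ℤ) + c i) q₂ = 1)) := by
    rw [hdvd_mul, hadm, ← hdvd_mod hmq hq₁0 ρ, ← hdvd_mod hnq hq₂0 ρ]
    tauto
  by_cases h : ((m * n : ℕ) : ℤ) ∣ α * ρ + β ∧ ∀ i, Int.gcd (a i * ρ + c i) (q₁ * q₂ : ℕ) = 1
  · rw [if_pos h, if_pos (hiff.mp h)]
  · rw [if_neg h, if_neg (mt hiff.mpr h)]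

/-! ### The weight at a prime -/

/-- At a prime `p ∣ α`: `w̃(p) = 𝟙[p ∣ β]` (`p' = 1`, one class, always admissible). [folklore] -/
theorem weight_prime_of_dvd {p : ℕ} (hp : p.Prime) (hpa : (p : ℤ) ∣ α) :
    W p = if (p : ℤ) ∣ β then 1 else 0 := by
  rw [hW, int_gcd_prime_right hp, if_pos hpa, Nat.div_self hp.pos, Finset.sum_range_one,
    card_admissible_one]
  simp

/-- At a prime `p ∤ α`: `w̃(p) = #{good roots} · (#{good classes})⁻¹` (`p' = p`). [folklore] -/
theorem weight_prime_of_not_dvd {p : ℕ} (hp : p.Prime) (hpa : ¬ (p : ℤ) ∣ α) :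
    W p = (#((range p).filter (fun ρ : ℕ => (p : ℤ) ∣ α * ρ + β ∧
        ∀ i, Int.gcd (a i * ρ + c i) p = 1)) : ℝ) *
      ((#((range p).filter (fun ρ' : ℕ => ∀ i, Int.gcd (a i * ρ' + c i) p = 1)) : ℝ))⁻¹ := by
  rw [hW, int_gcd_prime_right hp, if_neg hpa, Nat.div_one]
  simp_rw [← ite_and]
  rw [← Finset.sum_filter, Finset.sum_const, nsmul_eq_mul]

/-- **The weight at a prime.** For every prime `p`:
`w̃(p) · #{ρ < p : Φ-good} = #{ρ < p : p ∣ ψ(ρ), Φ-good}` (all three cases `p ∤ α`;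
`p ∣ α, p ∤ β`; `p ∣ α, p ∣ β`). [folklore] -/
theorem weight_prime_mul_card {p : ℕ} (hp : p.Prime) :
    W p * (#((range p).filter (fun ρ' : ℕ => ∀ i, Int.gcd (a i * ρ' + c i) p = 1)) : ℝ) =
      (#((range p).filter (fun ρ : ℕ => (p : ℤ) ∣ α * ρ + β ∧
        ∀ i, Int.gcd (a i * ρ + c i) p = 1)) : ℝ) := by
  by_cases hpa : (p : ℤ) ∣ α
  · rw [weight_prime_of_dvd a c α β hW hp hpa]
    have hiff : ∀ ρ : ℕ, (p : ℤ) ∣ α * ρ + β ↔ (p : ℤ) ∣ β := fun ρ =>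
      dvd_add_right (hpa.mul_right _)
    by_cases hpb : (p : ℤ) ∣ β
    · rw [if_pos hpb, one_mul]
      congr 2
      exact (Finset.filter_congr fun ρ _ => ⟨fun h => ⟨(hiff ρ).mpr hpb, h⟩, fun h => h.2⟩)
    · rw [if_neg hpb, zero_mul, eq_comm, Nat.cast_eq_zero, Finset.card_eq_zero,
        Finset.filter_eq_empty_iff]
      intro ρ _ h
      exact hpb ((hiff ρ).mp h.1)
  · rw [weight_prime_of_not_dvd a c α β hW hp hpa]
    set N : ℝ := (#((range p).filter (fun ρ' : ℕ => ∀ i, Int.gcd (a i * ρ' + c i) p = 1)) : ℝ)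
    rcases eq_or_ne N 0 with hN | hN
    · rw [hN, mul_zero, eq_comm, Nat.cast_eq_zero, Finset.card_eq_zero,
        ← Finset.subset_empty, ← Finset.card_eq_zero.mp (Nat.cast_eq_zero.mp hN)]
      exact Finset.monotone_filter_right _ fun ρ _ h => h.2
    · rw [inv_mul_cancel_right₀ hN]

end Weight

/-! ### Roots of a form modulo an unexceptional prime -/

/-- For a prime `p ∤ α` the congruence `α ρ + β ≡ 0 (mod p)` has exactly one solution `ρ < p`.
[folklore] -/
theorem card_roots_eq_one {p : ℕ} (hp : p.Prime) (α β : ℤ) (hpa : ¬ (p : ℤ) ∣ α) :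
    #((range p).filter (fun ρ : ℕ => (p : ℤ) ∣ α * ρ + β)) = 1 := by
  haveI := Fact.mk hp
  have hα : (α : ZMod p) ≠ 0 := fun h => hpa ((ZMod.intCast_zmod_eq_zero_iff_dvd α p).mp h)
  set ρ₀ : ℕ := (-(β : ZMod p) * (α : ZMod p)⁻¹).val with hρ₀
  rw [Finset.card_eq_one]
  refine ⟨ρ₀, Finset.eq_singleton_iff_unique_mem.mpr ⟨?_, ?_⟩⟩
  · rw [Finset.mem_filter, Finset.mem_range]
    refine ⟨ZMod.val_lt _, ?_⟩
    rw [← ZMod.intCast_zmod_eq_zero_iff_dvd]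
    push_cast
    rw [hρ₀, ZMod.natCast_zmod_val]
    field_simp
    ring
  · intro ρ hρ
    rw [Finset.mem_filter, Finset.mem_range] at hρ
    obtain ⟨hρp, hdvd⟩ := hρ
    rw [← ZMod.intCast_zmod_eq_zero_iff_dvd] at hdvd
    push_cast at hdvd
    have hρ' : ((ρ : ℕ) : ZMod p) = -(β : ZMod p) * (α : ZMod p)⁻¹ := by
      field_simp
      linear_combination hdvd
    rw [← Nat.mod_eq_of_lt hρp, ← ZMod.val_natCast, hρ', hρ₀]

/-- A root of `ψ` mod `p` is `Φ`-good as soon as `p ∤ α cᵢ - aᵢ β` for all `i`. [folklore] -/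
theorem good_of_root {p : ℕ} (hp : p.Prime) (a c : Fin t → ℤ) (α β : ℤ)
    (hΔ : ∀ i, ¬ (p : ℤ) ∣ α * c i - a i * β) {ρ : ℕ} (hρ : (p : ℤ) ∣ α * ρ + β) :
    ∀ i, Int.gcd (a i * ρ + c i) p = 1 := by
  intro i
  rw [int_gcd_prime_eq_one_iff hp]
  intro h
  refine hΔ i ?_
  have : α * c i - a i * β = α * (a i * ρ + c i) - a i * (α * ρ + β) := by ring
  rw [this]
  exact dvd_sub (h.mul_left α) (hρ.mul_left (a i))

/-- At most `t` classes mod `p` are `Φ`-bad when `p ∤ aᵢ` for all `i`: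
`p - t ≤ #{ρ < p : Φ-good}`. [folklore] -/
theorem card_good_ge {p : ℕ} (hp : p.Prime) (a c : Fin t → ℤ) (ha : ∀ i, ¬ (p : ℤ) ∣ a i) :
    p - t ≤ #((range p).filter (fun ρ' : ℕ => ∀ i, Int.gcd (a i * ρ' + c i) p = 1)) := by
  have hsplit := Finset.card_filter_add_card_filter_not (s := range p)
    (fun ρ' : ℕ => ∀ i, Int.gcd (a i * ρ' + c i) p = 1)
  rw [Finset.card_range] at hsplit
  have hbad : #((range p).filter (fun ρ' : ℕ => ¬ ∀ i, Int.gcd (a i * ρ' + c i) p = 1)) ≤ t := by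
    have hsub : (range p).filter (fun ρ' : ℕ => ¬ ∀ i, Int.gcd (a i * ρ' + c i) p = 1) ⊆
        (Finset.univ : Finset (Fin t)).biUnion
          (fun i => (range p).filter (fun ρ : ℕ => (p : ℤ) ∣ a i * ρ + c i)) := by
      intro ρ hρ
      rw [Finset.mem_filter] at hρ
      obtain ⟨hρp, hbad⟩ := hρ
      push Not at hbad
      obtain ⟨i, hi⟩ := hbad
      rw [Ne, int_gcd_prime_eq_one_iff hp, not_not] at hi
      exact Finset.mem_biUnion.mpr ⟨i, Finset.mem_univ _, Finset.mem_filter.mpr ⟨hρp, hi⟩⟩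
    calc #((range p).filter (fun ρ' : ℕ => ¬ ∀ i, Int.gcd (a i * ρ' + c i) p = 1))
        ≤ #((Finset.univ : Finset (Fin t)).biUnion
            (fun i => (range p).filter (fun ρ : ℕ => (p : ℤ) ∣ a i * ρ + c i))) :=
          Finset.card_le_card hsub
      _ ≤ ∑ i : Fin t, #((range p).filter (fun ρ : ℕ => (p : ℤ) ∣ a i * ρ + c i)) :=
          Finset.card_biUnion_le
      _ = t := by simp [card_roots_eq_one hp _ _ (ha _)]
  omega

section PrimeBounds

variable (a c : Fin t → ℤ) (α β : ℤ) {W : ℕ → ℝ}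
  (hW : ∀ d : ℕ, W d = ∑ ρ ∈ range (d / Int.gcd α d),
      if (d : ℤ) ∣ α * ρ + β then
        (if ∀ i, Int.gcd (a i * ρ + c i) (d / Int.gcd α d : ℕ) = 1 then
          ((#((range (d / Int.gcd α d)).filter (fun ρ' : ℕ =>
            ∀ i, Int.gcd (a i * ρ' + c i) (d / Int.gcd α d : ℕ) = 1)) : ℝ))⁻¹
        else 0)
      else 0)
include hW

/-- The crude bound `|1 - p w̃(p)| ≤ 1 + p` (from `0 ≤ w̃ ≤ 1`). [folklore] -/
theorem abs_one_sub_mul_weight_le (p : ℕ) : |1 - (p : ℝ) * W p| ≤ 1 + p := by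
  have h0 := weight_nonneg a c α β hW p
  have h1 := weight_le_one a c α β hW p
  have hp : (0 : ℝ) ≤ p := Nat.cast_nonneg p
  rw [abs_le]
  constructor
  · nlinarith
  · nlinarith

/-- **The weight at an unexceptional prime.** If `p ∤ α`, `p ∤ aᵢ`, `p ∤ α cᵢ - aᵢ β` for all
`i` and `2t < p`, then `w̃(p) = 1/#{good}` with `p - t ≤ #{good} ≤ p`, so
`|1 - p w̃(p)| ≤ t/(p - t) ≤ 2t/p`. [folklore] -/
theorem abs_one_sub_mul_weight_le_div {p : ℕ} (hp : p.Prime) (hpa : ¬ (p : ℤ) ∣ α)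
    (ha : ∀ i, ¬ (p : ℤ) ∣ a i) (hΔ : ∀ i, ¬ (p : ℤ) ∣ α * c i - a i * β) (htp : 2 * t < p) :
    |1 - (p : ℝ) * W p| ≤ 2 * t / p := by
  set N : ℕ := #((range p).filter (fun ρ' : ℕ => ∀ i, Int.gcd (a i * ρ' + c i) p = 1)) with hN
  have hNge : p - t ≤ N := card_good_ge hp a c ha
  have hNle : N ≤ p := by
    calc N ≤ #(range p) := Finset.card_filter_le _ _
      _ = p := Finset.card_range p
  have hroots : #((range p).filter (fun ρ : ℕ => (p : ℤ) ∣ α * ρ + β ∧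
      ∀ i, Int.gcd (a i * ρ + c i) p = 1)) = 1 := by
    have hfc : (range p).filter (fun ρ : ℕ => (p : ℤ) ∣ α * ρ + β ∧
        ∀ i, Int.gcd (a i * ρ + c i) p = 1) = (range p).filter (fun ρ : ℕ => (p : ℤ) ∣ α * ρ + β) :=
      Finset.filter_congr fun ρ _ => ⟨fun h => h.1, fun h => ⟨h, good_of_root hp a c α β hΔ h⟩⟩
    rw [hfc]
    exact card_roots_eq_one hp α β hpa
  have hkey := weight_prime_mul_card a c α β hW hp
  rw [hroots, Nat.cast_one, ← hN] at hkey
  -- real-number bookkeeping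
  have hp0 : (0 : ℝ) < p := by exact_mod_cast hp.pos
  have htp' : 2 * (t : ℝ) < p := by exact_mod_cast htp
  have hNge' : (p : ℝ) - t ≤ N := by
    have : ((p - t : ℕ) : ℝ) ≤ N := by exact_mod_cast hNge
    rwa [Nat.cast_sub (by omega)] at this
  have hNle' : (N : ℝ) ≤ p := by exact_mod_cast hNle
  have hN0 : (0 : ℝ) < N := by linarith
  have hpt : (p : ℝ) - t ≠ 0 := by linarith
  have hW' : W p = (N : ℝ)⁻¹ := by
    field_simp
    linarith [hkey]
  rw [hW', abs_le]
  constructor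
  · rw [neg_le_sub_iff_le_add]
    calc (p : ℝ) * (N : ℝ)⁻¹ = p / N := by rw [div_eq_mul_inv]
      _ ≤ p / (p - t) := by gcongr; linarith
      _ = 1 + t / (p - t) := by field_simp; ring
      _ ≤ 1 + 2 * t / p := by
          have hfrac : (t : ℝ) / (p - t) ≤ 2 * t / p := by
            rw [div_le_div_iff₀ (by linarith) hp0]
            nlinarith
          linarith
  · have : 1 ≤ (p : ℝ) * (N : ℝ)⁻¹ := by
      rw [← div_eq_mul_inv, one_le_div hN0]
      exact hNle'
    have h2 : 0 ≤ 2 * (t : ℝ) / p := by positivity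
    linarith

end PrimeBounds

/-! ### Registered sub-goal of this helper file -/

/-- **Part 1 of `stub_slopedEuler` (registered sub-goal `stub_slopedEuler_part1`).** The sieve
weight `w̃` of the sloped rung is multiplicative on coprime positive integers. [folklore] -/
theorem stub_slopedEuler_part1 :
    ∀ (t : ℕ) (a c : Fin t → ℤ) (α β : ℤ) (W : ℕ → ℝ), (∀ d : ℕ, W d = ∑ ρ ∈ Finset.range (d / Int.gcd α d), if (d : ℤ) ∣ α * ρ + β then (if ∀ i, Int.gcd (a i * ρ + c i) (d / Int.gcd α d : ℕ) = 1 then ((((Finset.range (d / Int.gcd α d)).filter (fun ρ' : ℕ => ∀ i, Int.gcd (a i * ρ' + c i) (d / Int.gcd α d : ℕ) = 1)).card : ℝ))⁻¹ else 0) else 0) → ∀ m n : ℕ, 0 < m → 0 < n → Nat.Coprime m n → W (m * n) = W m * W n :=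
  fun _ a c α β _ hW _ _ hm hn hmn => weight_mul a c α β hW hm hn hmn

end Summit.Parity.GeneralizedHardyLittlewood.Theorems.PairsToGHL.SlopedLadder
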